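import Summits.AtomisticToContinuum.Crystallization.Theorems.FrustratedLawDichotomyTwoShellRigidityAssemblyDial

/-!
# FrustratedLawDichotomy · two-shell rigidity — GRAM DATA of the two kissing patterns from the integer models

Rational bookkeeping for the pattern walks of the frame assembly (`…TwoShellRigidityPlacement.placement_step` takes Gram data only):
squared distances, bonds, square diagonals, non-bonds and INNER PRODUCTS of `fccTuple j, fccTuple k` (`= 1 − sqNormInt/4`) and of
`hcpTuple j, hcpTuple k` (`= 1 − sqNormInt/36`), each reduced to one `decide` on the integer model.  No `sorry`, no defs.
-/

noncomputable section

namespace Summit.AtomisticToContinuum.Crystallization.Theorems.FrustratedLawDichotomyTwoShellRigidityPatternGram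

open Literature.Geometry.DiscreteGeometry
open Literature.Geometry.DiscreteGeometry.ShellCensus
open Summit.AtomisticToContinuum.Crystallization.Theorems.FrustratedLawDichotomyTwoShellRigidityCut (E3)
open Summit.AtomisticToContinuum.Crystallization.Theorems.FrustratedLawDichotomyTwoShellRigidityAssemblyDial
  (dist_hcpTuple fccTuple_mem hcpTuple_mem)
open scoped RealInnerProductSpace

/-- Squared distances in the fcc tuple: `dist² = sqNormInt/2`. [folklore] -/
theorem dist_sq_fccTuple (j k : Fin 12) : dist (fccTuple j) (fccTuple k) ^ 2 = (sqNormInt (fccVec j - fccVec k) : ℝ) / 2 := by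
  have h0 : (0 : ℝ) ≤ (sqNormInt (fccVec j - fccVec k) : ℝ) := by
    have : (0 : ℤ) ≤ sqNormInt (fccVec j - fccVec k) := by unfold sqNormInt; positivity
    exact_mod_cast this
  rw [dist_fccTuple, mul_pow, inv_pow, Real.sq_sqrt (by norm_num), Real.sq_sqrt h0]
  ring

/-- Squared distances in the hcp tuple: `dist² = sqNormInt/18`. [folklore] -/
theorem dist_sq_hcpTuple (j k : Fin 12) : dist (hcpTuple j) (hcpTuple k) ^ 2 = (sqNormInt (hcpVec j - hcpVec k) : ℝ) / 18 := by
  have h0 : (0 : ℝ) ≤ (sqNormInt (hcpVec j - hcpVec k) : ℝ) := by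
    have : (0 : ℤ) ≤ sqNormInt (hcpVec j - hcpVec k) := by unfold sqNormInt; positivity
    exact_mod_cast this
  rw [dist_hcpTuple, mul_pow, inv_pow, Real.sq_sqrt (by norm_num), Real.sq_sqrt h0]
  ring

/-- Inner products in the fcc tuple: `⟪vⱼ, v_k⟫ = 1 − sqNormInt(vⱼ − v_k)/4`. [folklore] -/
theorem inner_fccTuple (j k : Fin 12) : ⟪fccTuple j, fccTuple k⟫ = 1 - (sqNormInt (fccVec j - fccVec k) : ℝ) / 4 := by
  have h : ‖fccTuple j - fccTuple k‖ ^ 2 = ‖fccTuple j‖ ^ 2 - 2 * ⟪fccTuple j, fccTuple k⟫ + ‖fccTuple k‖ ^ 2 :=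
    norm_sub_sq_real _ _
  rw [← dist_eq_norm, dist_sq_fccTuple, norm_eq_one_of_mem_fccKissingPattern (fccTuple_mem j),
    norm_eq_one_of_mem_fccKissingPattern (fccTuple_mem k)] at h
  linarith

/-- Inner products in the hcp tuple: `⟪vⱼ, v_k⟫ = 1 − sqNormInt(vⱼ − v_k)/36`. [folklore] -/
theorem inner_hcpTuple (j k : Fin 12) : ⟪hcpTuple j, hcpTuple k⟫ = 1 - (sqNormInt (hcpVec j - hcpVec k) : ℝ) / 36 := by
  have h : ‖hcpTuple j - hcpTuple k‖ ^ 2 = ‖hcpTuple j‖ ^ 2 - 2 * ⟪hcpTuple j, hcpTuple k⟫ + ‖hcpTuple k‖ ^ 2 :=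
    norm_sub_sq_real _ _
  rw [← dist_eq_norm, dist_sq_hcpTuple, norm_eq_one_of_mem_hcpKissingPattern (hcpTuple_mem j),
    norm_eq_one_of_mem_hcpKissingPattern (hcpTuple_mem k)] at h
  linarith

/-- A distance from its square (both nonnegative). [folklore] -/
theorem dist_eq_of_sq {x y : E3} {a : ℝ} (ha : 0 ≤ a) (h : dist x y ^ 2 = a ^ 2) : dist x y = a :=
  (sq_eq_sq₀ dist_nonneg ha).1 h

/-- fcc square diagonal from the integer model. [folklore] -/
theorem dist_fccTuple_eq_sqrt_two {j k : Fin 12} (h : sqNormInt (fccVec j - fccVec k) = 4) :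
    dist (fccTuple j) (fccTuple k) = Real.sqrt 2 := by
  apply dist_eq_of_sq (Real.sqrt_nonneg 2)
  rw [dist_sq_fccTuple, h, Real.sq_sqrt (by norm_num)]
  norm_num

/-- hcp square diagonal from the integer model. [folklore] -/
theorem dist_hcpTuple_eq_sqrt_two {j k : Fin 12} (h : sqNormInt (hcpVec j - hcpVec k) = 36) :
    dist (hcpTuple j) (hcpTuple k) = Real.sqrt 2 := by
  apply dist_eq_of_sq (Real.sqrt_nonneg 2)
  rw [dist_sq_hcpTuple, h, Real.sq_sqrt (by norm_num)]
  norm_num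

/-- fcc non-bond from the integer model. [folklore] -/
theorem dist_fccTuple_ne_one {j k : Fin 12} (h : sqNormInt (fccVec j - fccVec k) ≠ 2) : dist (fccTuple j) (fccTuple k) ≠ 1 := by
  intro h1
  have h2 := dist_sq_fccTuple j k
  rw [h1, one_pow] at h2
  have : (sqNormInt (fccVec j - fccVec k) : ℝ) = 2 := by linarith
  exact h (by exact_mod_cast this)

/-- hcp non-bond from the integer model. [folklore] -/
theorem dist_hcpTuple_ne_one {j k : Fin 12} (h : sqNormInt (hcpVec j - hcpVec k) ≠ 18) : dist (hcpTuple j) (hcpTuple k) ≠ 1 := by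
  intro h1
  have h2 := dist_sq_hcpTuple j k
  rw [h1, one_pow] at h2
  have : (sqNormInt (hcpVec j - hcpVec k) : ℝ) = 18 := by linarith
  exact h (by exact_mod_cast this)

/-- Distinct indices give distinct fcc points. [folklore] -/
theorem fccTuple_ne {j k : Fin 12} (h : j ≠ k) : fccTuple j ≠ fccTuple k := fun e => h (fccTuple_injective e)

/-- Distinct indices give distinct hcp points. [folklore] -/
theorem hcpTuple_ne {j k : Fin 12} (h : j ≠ k) : hcpTuple j ≠ hcpTuple k := fun e => h (hcpTuple_injective e)

/-- The fcc point `k` as an element of the pattern subtype equals any subtype element with the same value. [folklore] -/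
theorem fcc_subtype_eq {z : ↥fccKissingPattern} {k : Fin 12} (h : fccTuple k = (z : E3)) :
    z = ⟨fccTuple k, fccTuple_mem k⟩ := Subtype.ext h.symm

/-- The hcp point `k` as an element of the pattern subtype equals any subtype element with the same value. [folklore] -/
theorem hcp_subtype_eq {z : ↥hcpKissingPattern} {k : Fin 12} (h : hcpTuple k = (z : E3)) :
    z = ⟨hcpTuple k, hcpTuple_mem k⟩ := Subtype.ext h.symm

end Summit.AtomisticToContinuum.Crystallization.Theorems.FrustratedLawDichotomyTwoShellRigidityPatternGram

end
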